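import Summits.QuantumFields.BalabanUV.T4Continuum.Support.NE7HessianFloorModGauge
import Summits.QuantumFields.BalabanUV.T4Continuum.Support.NE7BorderedHessianGaugeDegenerate
import Summits.QuantumFields.BalabanUV.T4Continuum.Support.NE7SecondVariationHess
import HarnessLib

/-!
# NE7SliceReachBordered — (i)+(ii) OF THE (G′) ASSEMBLY SHAPE FOR THE MULTI-LEVEL SLICE, IN ONE STATEMENT: every fibre element `X` reaches, by a corner-trivial gauge direction `ξ_μ`,
# a representative `X′ = X + ξ_μ` with (a) `levelQ′ X′ = levelQ′ X`, (b) THE SAME BORDERED VALUE `w·D²𝒜(0)[X′,X′] − Λ(D²𝒢(0)[X′,X′]) = w·D²𝒜(0)[X,X] − Λ(D²𝒢(0)[X,X])` for every `(w, Λ)` with the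
# multiplier identity `w·D𝒜(0) = Λ∘D𝒢(0)` (row NE7b's ✓ `borderedForm_add_gaugeDir`), (c) `D²𝒜(0)[X′,X′] = hess U X̃′ X̃′ Wn` (✓ `second_variation`), and (d) THE HESSIAN FLOOR of this gen's G4
# `Σ_P nhs(curl_{V₀}ṽ) ≤ ((1+θ) + 2K·4C_P·n)·hess U X̃′ X̃′ (perWin) + 2K(2liftMassC + 4C_P liftCurlC)‖ṽ‖²` (d = 4; lineage `b2b-balaban-t4-ne7-p1`, gen 118, file G10; G7's `hreach` ∧ `hfloor`
# for `S = R₀ṽ + T_♮(U)`)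

Cell `pub-balaban`, rung (B)+1 sub-cell t4, CRUX PROVER NE7 #1 (OWNER of row NE7), generation 118.  Composition BY NAME of ✓ `NE7HessianFloorModGauge.exists_cornerGauge_hess_floor` (G4), row NE7b's
✓ `NE7BorderedHessianGaugeDegenerate.borderedForm_add_gaugeDir` (gen 161) and this lineage's ✓ `NE7SecondVariationHess.second_variation` (gen 115).  The class «with room» of the bordered
identity (`x < x′`, `LevelSmall 4 L j x′`) and the multiplier identity `hcrit` are displayed (the all-data package ✓ `minAct_hessian_hessForm_allData` ∕ ✓ `NE7MinActMultiplier` supplies them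
for minimisers).  WHAT ([folklore]; 0 def, 0 sorry; `d = 4`, `n : Type`): **`exists_cornerGauge_reach_floor`**.
HONEST FRAMING: packaging of landed kernel theorems; the multiplier LETTER (iii) of G7 is NOT here (open: hierarchical representative); nothing of Bałaban's asserted; NOT (G′), NOT NE7 as a
spine node; spine 0∕9; finite T⁴ rung (B)+1 — NOT infinite volume, NOT mass gap, NOT BetaPertH, NOT Clay.
-/

set_option autoImplicit false

open scoped BigOperators Matrix Matrix.Norms.L2Operator
open NormedSpace Finset

namespace Summit.QuantumFields.BalabanUV.T4Continuum.NE7SliceReachBordered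

open Literature.MathematicalPhysics.QuantumFieldTheory.Balaban1983to89
open B7Prop1Explicit B7Prop2Explicit MatrixLog UnitaryModel
open T4AveragingDeficitWall (IsUnitaryCfg IsSkewDir SmallField Ad curl curlAt curlSq dirSq fineAction)
open T4AveragingDeficitWallBoundary (IsPeriodicCfg periodBox)
open AveragingDeficitTorusChart (TDir chart chartDir resDir)
open AveragingDeficitTwoLevelPrep (twoLevelSmall skewSub skewPR)
open AveragingDeficitMultiLevelPrep (cavgIter tower levelQ levelQ' LevelSmall)
open MatrixNorms (nhsNormSq)
open MinimalActionLevels (perWin)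
open NE3HessForm (hess)
open NE7RadIterUniform (radD)
open NE7StraightTowerCurlEnergy (eC mC)
open BlockAveragePushDirGauge (gaugeDir)
open NE3QbarIterCovLiftPrep (cruxC)
open NE3RightInverseSolveLetters (thetaLoc)
open NE3SlicePoincareShape (SlicePoincare)
open NE3FrameFreeSliceW (frameFreeBlockLandauW)
open NE7SliceRepHessianFloor (liftMassC liftCurlC sliceRep_args)
open NE7HessianFloorModGauge (exists_cornerGauge_hess_floor)
open NE7BorderedHessianGaugeDegenerate (borderedForm_add_gaugeDir)
open NE7SecondVariationHess (second_variation)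

noncomputable section

variable {n : Type} [Fintype n] [DecidableEq n]

/-- **REACH + FLOOR FOR THE MULTI-LEVEL SLICE** (`d = 4`, every `U(n)`, `L ≥ 2`, j-, N-uniform constants; see the module docstring).  Hypotheses: those of G4 ✓ `exists_cornerGauge_hess_floor`,
a radius with room `ε·L^{−2(j+1)} < x′`, `LevelSmall 4 L j x′`, a window `Wn`, a weight `w`, a functional `Λ` with the multiplier identity on `skewSub M`. [folklore] -/
theorem exists_cornerGauge_reach_floor [Nonempty n] {L N : ℕ} [NeZero L] [NeZero N] (hL : 2 ≤ L) (hN : 1 ≤ N) {ε : ℝ} (hε : 0 ≤ ε)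
    (hεD : 4 * ε * radD 4 L * (((L : ℝ) ^ 2)⁻¹) ^ 2 ≤ 1) (hεT : twoLevelSmall 4 L * (2 * ε * ((L : ℝ) ^ 2)⁻¹) ≤ 1)
    (hεM : 8 * (L : ℝ) * mC 4 L (Fintype.card n) * ε * ((L : ℝ) ^ 2)⁻¹ ≤ 1) (hε1 : ε ≤ 1) (hcrux : cruxC 4 L * ε < 1)
    (hθl2 : thetaLoc 4 L * ε ≤ 1 / 2) (hEl : 43584 * ε ≤ 1 / 2) (j : ℕ)
    {U : Site 4 → Fin 4 → (Matrix n n ℂ)ˣ} (hU : IsUnitaryCfg U) (hUP : IsPeriodicCfg U ((tower L N (j + 1) : ℕ) : ℤ))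
    (hUx : SmallField U (ε * (((L : ℝ) ^ 2)⁻¹) ^ (j + 1))) {x' : ℝ} (hxx' : ε * (((L : ℝ) ^ 2)⁻¹) ^ (j + 1) < x') (hs' : LevelSmall 4 L j x')
    {CP : ℝ} (hCP : 0 ≤ CP) (hSP : SlicePoincare L (j + 1) U (frameFreeBlockLandauW (d := 4) (n := n) L N (j + 1) U) CP (periodBox (N * L ^ (j + 1))))
    (habs : 28 * (Fintype.card (T4AveragingDeficitWall.Plane 4) : ℝ) * ε * (4 * CP * Fintype.card n) ≤ 1) {θ : ℝ} (hθ : 0 < θ)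
    (Wn : Finset (T4AveragingDeficitWall.Plaq 4)) (w : ℝ) (Λ : ↥(skewSub 4 n N) →L[ℝ] ℝ)
    (hcrit : ∀ Z : ↥(skewSub 4 n (L * tower L N j)),
      w * fderiv ℝ (fun Φ : ↥(skewSub 4 n (L * tower L N j)) =>
          fineAction (chart (ContinuousLinearMap.id ℝ (Matrix n n ℂ)) (L * tower L N j) U (Φ : TDir 4 n (L * tower L N j))) Wn) 0 Z
        = Λ (fderiv ℝ (fun Φ : ↥(skewSub 4 n (L * tower L N j)) =>
          levelQ L N j U (chart (ContinuousLinearMap.id ℝ (Matrix n n ℂ)) (L * tower L N j) U (Φ : TDir 4 n (L * tower L N j)))) 0 Z))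
    (X : ↥(skewSub 4 n (L * tower L N j))) :
    ∃ mu : Site 4 → Matrix n n ℂ, (∀ y, mu y ∈ skewAdjoint (Matrix n n ℂ))
      ∧ (∀ (y : Site 4) (i : Fin 4), mu (y + ((L * tower L N j : ℕ) : ℤ) • e i) = mu y)
      ∧ (∀ w' : Site 4, mu (((L : ℤ) ^ (j + 1)) • w') = 0)
      ∧ levelQ' L N j U ((X + skewPR (d := 4) (n := n) (L * tower L N j) (resDir (L * tower L N j) (gaugeDir U mu)) : ↥(skewSub 4 n (L * tower L N j)))
            : TDir 4 n (L * tower L N j)) = levelQ' L N j U (X : TDir 4 n (L * tower L N j))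
      ∧ (w * fderiv ℝ (fderiv ℝ (fun Φ : ↥(skewSub 4 n (L * tower L N j)) =>
              fineAction (chart (ContinuousLinearMap.id ℝ (Matrix n n ℂ)) (L * tower L N j) U (Φ : TDir 4 n (L * tower L N j))) Wn)) 0
              (X + skewPR (d := 4) (n := n) (L * tower L N j) (resDir (L * tower L N j) (gaugeDir U mu)))
              (X + skewPR (d := 4) (n := n) (L * tower L N j) (resDir (L * tower L N j) (gaugeDir U mu)))
          - Λ (fderiv ℝ (fderiv ℝ (fun Φ : ↥(skewSub 4 n (L * tower L N j)) =>
              levelQ L N j U (chart (ContinuousLinearMap.id ℝ (Matrix n n ℂ)) (L * tower L N j) U (Φ : TDir 4 n (L * tower L N j))))) 0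
              (X + skewPR (d := 4) (n := n) (L * tower L N j) (resDir (L * tower L N j) (gaugeDir U mu)))
              (X + skewPR (d := 4) (n := n) (L * tower L N j) (resDir (L * tower L N j) (gaugeDir U mu))))
        = w * fderiv ℝ (fderiv ℝ (fun Φ : ↥(skewSub 4 n (L * tower L N j)) =>
              fineAction (chart (ContinuousLinearMap.id ℝ (Matrix n n ℂ)) (L * tower L N j) U (Φ : TDir 4 n (L * tower L N j))) Wn)) 0 X X
          - Λ (fderiv ℝ (fderiv ℝ (fun Φ : ↥(skewSub 4 n (L * tower L N j)) =>
              levelQ L N j U (chart (ContinuousLinearMap.id ℝ (Matrix n n ℂ)) (L * tower L N j) U (Φ : TDir 4 n (L * tower L N j))))) 0 X X))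
      ∧ fderiv ℝ (fderiv ℝ (fun Φ : ↥(skewSub 4 n (L * tower L N j)) =>
              fineAction (chart (ContinuousLinearMap.id ℝ (Matrix n n ℂ)) (L * tower L N j) U (Φ : TDir 4 n (L * tower L N j))) Wn)) 0
              (X + skewPR (d := 4) (n := n) (L * tower L N j) (resDir (L * tower L N j) (gaugeDir U mu)))
              (X + skewPR (d := 4) (n := n) (L * tower L N j) (resDir (L * tower L N j) (gaugeDir U mu)))
          = hess U (chartDir (ContinuousLinearMap.id ℝ (Matrix n n ℂ)) (L * tower L N j)
                ((X + skewPR (d := 4) (n := n) (L * tower L N j) (resDir (L * tower L N j) (gaugeDir U mu)) : ↥(skewSub 4 n (L * tower L N j))) : TDir 4 n (L * tower L N j)))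
              (chartDir (ContinuousLinearMap.id ℝ (Matrix n n ℂ)) (L * tower L N j)
                ((X + skewPR (d := 4) (n := n) (L * tower L N j) (resDir (L * tower L N j) (gaugeDir U mu)) : ↥(skewSub 4 n (L * tower L N j))) : TDir 4 n (L * tower L N j))) Wn
      ∧ ∑ P ∈ perWin 4 N, nhsNormSq
          (curl (cavgIter L (j + 1) U) (chartDir (ContinuousLinearMap.id ℝ (Matrix n n ℂ)) N ((levelQ' L N j U (X : TDir 4 n (L * tower L N j)) : ↥(skewSub 4 n N)) : TDir 4 n N)) P)
        ≤ ((1 + θ) + 2 * ((1 + θ) * (14 * (Fintype.card (T4AveragingDeficitWall.Plane 4) : ℝ) * ε) + (1 + θ⁻¹) * (36 * eC 4 L (Fintype.card n) ^ 2 * ε ^ 2))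
              * (4 * CP * Fintype.card n))
            * hess U (chartDir (ContinuousLinearMap.id ℝ (Matrix n n ℂ)) (L * tower L N j)
                  ((X + skewPR (d := 4) (n := n) (L * tower L N j) (resDir (L * tower L N j) (gaugeDir U mu)) : ↥(skewSub 4 n (L * tower L N j))) : TDir 4 n (L * tower L N j)))
                (chartDir (ContinuousLinearMap.id ℝ (Matrix n n ℂ)) (L * tower L N j)
                  ((X + skewPR (d := 4) (n := n) (L * tower L N j) (resDir (L * tower L N j) (gaugeDir U mu)) : ↥(skewSub 4 n (L * tower L N j))) : TDir 4 n (L * tower L N j)))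
                (perWin 4 (tower L N (j + 1)))
          + 2 * ((1 + θ) * (14 * (Fintype.card (T4AveragingDeficitWall.Plane 4) : ℝ) * ε) + (1 + θ⁻¹) * (36 * eC 4 L (Fintype.card n) ^ 2 * ε ^ 2))
              * ((2 * liftMassC 4 L + 4 * CP * liftCurlC 4 L)
                  * dirSq (chartDir (ContinuousLinearMap.id ℝ (Matrix n n ℂ)) N ((levelQ' L N j U (X : TDir 4 n (L * tower L N j)) : ↥(skewSub 4 n N)) : TDir 4 n N))
                      (periodBox N)) := by
  have hL1 : 1 ≤ L := by omega
  obtain ⟨hx, -, -, -⟩ := sliceRep_args hL hε hεD hεT hcrux hEl j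
  obtain ⟨mu, hmus, hmuP, hmu0, hq, hfloor⟩ :=
    exists_cornerGauge_hess_floor hL hN hε hεD hεT hεM hε1 hcrux hθl2 hEl j hU hUP hUx hCP hSP habs hθ X
  have hUP' : IsPeriodicCfg U ((L * tower L N j : ℕ) : ℤ) := hUP
  obtain ⟨-, hB⟩ := borderedForm_add_gaugeDir (d := 4) hL1 j hU hUP' hx hxx' hs' hUx hmus hmuP hmu0 Wn w Λ hcrit X
  exact ⟨mu, hmus, hmuP, hmu0, hq, hB, second_variation U Wn _, hfloor⟩

end

end Summit.QuantumFields.BalabanUV.T4Continuum.NE7SliceReachBordered
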